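import Summits.QuantumFields.YangMills.Theorems.SwapVirialDeficitSectorLaplaceEndGaussShellPoint
import Summits.QuantumFields.YangMills.Theorems.SwapVirialDeficitBlowUpGnomonicRotCovariance
import Summits.QuantumFields.YangMills.Theorems.SwapVirialDeficitBlowUpGnomonicFibreHessianAngle
import HarnessLib

/-!
# Route `SwapVirialDeficit` (YangMills): THE FOLLOWER DETERMINANT AT A TIP NEAR-POINT, MATCHED MODULO THE ROTATION — hCore brick (iii) of w3 g68's design (STATUS 01:13Z)
# (cell ym-idea-1, skeleton ➎, `stub_core_tip`, the core `δ_t > δ_b`; free-hands support of ⟨stmt-QuantumFields-24197⟩ `SwapVirialDeficit.SwapGluedStiffness`)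

In the tip core the soft pair (the joint tilt of both leaders) is populated up to `O(1)`, so the follower determinant `det A_F^{θ_t}(η)` at a near point `η` of the tip hub
`angUnit θ_t` is NOT within the flat matching radius of the base point below it.  It is, however, after the exact apex symmetry: if `η = gnoRot u ζ` with `ζ` flat-near a base
point `gnoBase p′`, then
`det A_F^{θ_t}(η) ≈_{e} det A_F^{apex}(η) = det A_F^{apex}(gnoRot u ζ) = det A_F^{apex}(ζ) ≈_{e} det A_F^{apex}(gnoBase p′) ≈_{e} det A_F^{θ_s}(gnoBase p′)`
(angle matching ✓`abs_log_det_gnoFolHessian_sub_le_joint` (w2 g60), LEAD g99's apex isotropy ✓`det_gnoFolHessian_apex_rot` — EXACT —, translation matching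
✓`abs_log_det_gnoFolHessian_sub_le` with g48's base coercivity ✓`gnoFolHessian_coercive_base`).  The one missing link — the coercivity of the apex family at the
ROTATED point `η` (needed by the angle step) — is the conjugacy hidden inside the proof of ✓`det_gnoFolHessian_apex_rot`, exported here:
* ★ `exists_gnoFolRot_form` — apex family `A₀` (hub `1`, central character), `‖u‖ = 1`: `∃ R : V_F ≃ₗᵢ V_F, ∀ η y, ⟪A₀ η y, y⟫ = ⟪A₀ (gnoRot u η) (R y), R y⟫`;
  `gnoFolHessian_apex_coercive_rot` — `μ′`-coercivity of `A₀` at `ζ` ⟹ at `gnoRot u ζ` (same `μ′`).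
* ★★★ `abs_log_det_tip_mod_rot` — tip family `A_t` (hub `angUnit θ_t`, `0 ≤ sin θ_t`, angle window `122689728·|θ_t|·L⁴ ≤ μ_F∕(4·3|Fol L|)`), apex family `A₀`, unit `u`,
  `ζ` flat-near `gnoBase p′` (`44712000·L⁴·‖ζ − gnoBase p′‖ ≤ μ_F∕(2·3|Fol L|)`): `|log det A_t(gnoRot u ζ) − log det A₀(gnoBase p′)| ≤ 2`.
* ★★ `abs_log_det_apex_base_le` — `|log det A₀(gnoBase p′) − log det A_s(gnoBase p′)| ≤ 1` for any hub `angUnit θ_s` in the angle window (so the tip near-point determinant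
  is within `e³` of the SHELL determinant at `p′` — g49's shell currency — or within `e²` of `D_apex(p′)` — g68's).

HONEST LABEL: composition of landed bricks; hCore's letters∕Jacobian (F1–F3, g68), the `p`-scaling Fubini (iv), the stiff-far tail, T1 at the tip hub and the assembly of
`stub_core_tip`, ⟨24197⟩ ∕ ⟨24194⟩ remain OPEN; own crux ⟨22884⟩ `LargeFieldMassRefinementTail` OPEN (blocked-on ⟨19935⟩); the Yang–Mills mass gap is NOT proved; no summit
is proved by a line.  THEOREMS ONLY (0 `def`, 0 `sorry`, no instance), standard axioms.  Width seat ym-line-sfw-p2-w2 g61 (cell ym-idea-1, free hands), `--supports stmt-QuantumFields-24197`.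
References: [cite: Luscher1983, §2]; [cite: Breitung1994, Lemma 26]; [folklore].
-/

set_option autoImplicit false
set_option synthInstance.maxSize 1024

noncomputable section

open MeasureTheory Quaternion Set Module
open scoped Quaternion BigOperators ENNReal InnerProductSpace ContDiff
open Literature.MathematicalPhysics.QuantumLattice
open Literature.MathematicalPhysics.QuantumFieldTheory hiding SU2

namespace Summit.QuantumFields.YangMills.Theorems.SwapVirialDeficit.SectorLaplace

open Summit.QuantumFields.YangMills.Theorems.FemtoTransferGap
open Summit.QuantumFields.YangMills.Theorems.FemtoTransferGap.TT
open Summit.QuantumFields.YangMills.Theorems.VirialFluxGap.RingDeficit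
open Summit.QuantumFields.YangMills.Theorems.SwapVirialDeficit.SwapRing
open Summit.QuantumFields.YangMills.Theorems.SwapVirialDeficit.BlowUpRing

variable {L : ℕ} [NeZero L]

/-! ## §1 The apex conjugacy of the follower Hessian, exported -/

/-- ★ **THE APEX CONJUGACY**: for a follower-Hessian family `A₀` at the apex hub `1` (central character `χ`, fibre form identity) and a unit quaternion `u` there is a
linear isometry equivalence `R` of `V_F` with `⟪A₀ η y, y⟫ = ⟪A₀ (gnoRot u η) (R y), R y⟫` for ALL `η, y` (LEAD g99's ✓`gnoDeficit_realHub_rot` + w2 g60's ✓`exists_gnoFolRot`;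
the identity inside the proof of ✓`det_gnoFolHessian_apex_rot`). [folklore] -/
theorem exists_gnoFolRot_form (z : Fin 3 → Bool) {χ : Site 3 L → SU2} (hχ : ∀ (x : Site 3 L) (k : SU2), k * χ x = χ x * k) (ε : GnoSign L)
    {A : GnoCoord L → GnoFol L →ₗ[ℝ] GnoFol L}
    (hAyy : ∀ η (y : GnoFol L), ⟪A η y, y⟫_ℝ = iteratedFDeriv ℝ 2 (fun y' : GnoFol L => gnoDeficit z χ ((1 : ℝ) : ℍ) ε (η + gnoFolEmb y')) 0 (fun _ => y))
    {u : ℍ} (hu : ‖u‖ = 1) :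
    ∃ R : GnoFol L ≃ₗᵢ[ℝ] GnoFol L, ∀ (η : GnoCoord L) (y : GnoFol L), ⟪A η y, y⟫_ℝ = ⟪A (gnoRot u η) (R y), R y⟫_ℝ := by
  obtain ⟨R, -, hRη⟩ := exists_gnoFolRot (L := L) hu
  refine ⟨R, fun η y => ?_⟩
  have hfun : (fun y' : GnoFol L => gnoDeficit z χ ((1 : ℝ) : ℍ) ε (η + gnoFolEmb y')) =
      (fun y' : GnoFol L => gnoDeficit z χ ((1 : ℝ) : ℍ) ε (gnoRot u η + gnoFolEmb y')) ∘ (R : GnoFol L → GnoFol L) := by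
    funext y'
    simp only [Function.comp_apply]
    rw [← hRη η y', gnoDeficit_realHub_rot z hχ one_ne_zero hu]
  rw [hAyy, hAyy, hfun]
  have hG : ContDiff ℝ 2 (fun y' : GnoFol L => gnoDeficit z χ ((1 : ℝ) : ℍ) ε (gnoRot u η + gnoFolEmb y')) :=
    contDiff_gnoDeficit_fol (n := 2) z χ (by exact_mod_cast one_ne_zero) ε _
  have h2 : ((2 : ℕ) : WithTop ℕ∞) ≤ ((2 : ℕ∞) : WithTop ℕ∞) := le_rfl
  rw [show (R : GnoFol L → GnoFol L) = ((R : GnoFol L ≃ₗᵢ[ℝ] GnoFol L).toLinearIsometry.toContinuousLinearMap : GnoFol L → GnoFol L) from rfl,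
    ContinuousLinearMap.iteratedFDeriv_comp_right _ hG _ h2]
  simp

/-- ★ **COERCIVITY TRANSFERS ALONG THE APEX ORBIT**: if the apex family is `μ′`-coercive at `ζ`, it is `μ′`-coercive at `gnoRot u ζ` (`‖u‖ = 1`). [folklore] -/
theorem gnoFolHessian_apex_coercive_rot (z : Fin 3 → Bool) {χ : Site 3 L → SU2} (hχ : ∀ (x : Site 3 L) (k : SU2), k * χ x = χ x * k) (ε : GnoSign L)
    {A : GnoCoord L → GnoFol L →ₗ[ℝ] GnoFol L}
    (hAyy : ∀ η (y : GnoFol L), ⟪A η y, y⟫_ℝ = iteratedFDeriv ℝ 2 (fun y' : GnoFol L => gnoDeficit z χ ((1 : ℝ) : ℍ) ε (η + gnoFolEmb y')) 0 (fun _ => y))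
    {u : ℍ} (hu : ‖u‖ = 1) {ζ : GnoCoord L} {μ' : ℝ} (hcoer : ∀ y : GnoFol L, μ' * ‖y‖ ^ 2 ≤ ⟪A ζ y, y⟫_ℝ) (w : GnoFol L) :
    μ' * ‖w‖ ^ 2 ≤ ⟪A (gnoRot u ζ) w, w⟫_ℝ := by
  obtain ⟨R, hR⟩ := exists_gnoFolRot_form z hχ ε hAyy hu
  have h := hcoer (R.symm w)
  rw [hR ζ (R.symm w), LinearIsometryEquiv.apply_symm_apply, LinearIsometryEquiv.norm_map] at h
  exact h

/-! ## §2 The tip near-point determinant against the apex base point -/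

set_option maxHeartbeats 800000 in
/-- ★★★ **THE FOLLOWER DETERMINANT AT A TIP NEAR-POINT, MODULO THE ROTATION.**  Good signs; `A_t` a follower-Hessian family at the tip hub `angUnit θ_t` (`0 ≤ sin θ_t`,
ambient form identity) in the angle window `122689728·|θ_t|·L⁴ ≤ μ_F∕(4·3|Fol L|)`; `A₀` a family at the apex hub `1` (fibre, ray and ambient identities); `‖u‖ = 1`; `ζ`
flat-near the base point: `44712000·L⁴·‖ζ − gnoBase p′‖ ≤ μ_F∕(2·3|Fol L|)`.  Then `|log det A_t(gnoRot u ζ) − log det A₀(gnoBase p′)| ≤ 2`. [cite: Breitung1994, Lemma 26] -/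
theorem abs_log_det_tip_mod_rot {ε : GnoSign L} (hε : GoodSign ε) {θt : ℝ} (hθt : 0 ≤ Real.sin θt)
    {At : GnoCoord L → GnoFol L →ₗ[ℝ] GnoFol L} (hAts : ∀ η, (At η).IsSymmetric)
    (hAtamb : ∀ η (y : GnoFol L), ⟪At η y, y⟫_ℝ = iteratedFDeriv ℝ 2 (gnoDeficit z₀ (fun _ => 1) (angUnit θt) ε) η (fun _ => gnoFolEmb y))
    {A0 : GnoCoord L → GnoFol L →ₗ[ℝ] GnoFol L} (hA0s : ∀ η, (A0 η).IsSymmetric)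
    (hA0yy : ∀ η (y : GnoFol L), ⟪A0 η y, y⟫_ℝ = iteratedFDeriv ℝ 2 (fun y' : GnoFol L => gnoDeficit z₀ (fun _ => 1) ((1 : ℝ) : ℍ) ε (η + gnoFolEmb y')) 0 (fun _ => y))
    (hA0ray : ∀ η (y : GnoFol L), ⟪A0 η y, y⟫_ℝ = iteratedDeriv 2 (fun s : ℝ => gnoDeficit (fun _ => false) (fun _ => 1) ((1 : ℝ) : ℍ) ε (η + s • gnoFolEmb y)) 0)
    (hA0amb : ∀ η (y : GnoFol L), ⟪A0 η y, y⟫_ℝ = iteratedFDeriv ℝ 2 (gnoDeficit z₀ (fun _ => 1) ((1 : ℝ) : ℍ) ε) η (fun _ => gnoFolEmb y))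
    (hwinθ : 122689728 * |θt| * (L : ℝ) ^ 4 ≤ (2304 * (L : ℝ) ^ 6 * (Fintype.card (Fol L) : ℝ))⁻¹ / (4 * (3 * (Fintype.card (Fol L) : ℝ))))
    {u : ℍ} (hu : ‖u‖ = 1) (ζ : GnoCoord L) (p' : ℝ × ℝ)
    (hflat : 44712000 * (L : ℝ) ^ 4 * ‖ζ - gnoBase p'.1 p'.2‖ ≤ (2304 * (L : ℝ) ^ 6 * (Fintype.card (Fol L) : ℝ))⁻¹ / (2 * (3 * (Fintype.card (Fol L) : ℝ)))) :
    |Real.log (LinearMap.det (At (gnoRot u ζ))) - Real.log (LinearMap.det (A0 (gnoBase p'.1 p'.2)))| ≤ 2 := by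
  have hL : (0 : ℝ) < (L : ℝ) := Nat.cast_pos.2 (Nat.pos_of_ne_zero (NeZero.ne L))
  set μ : ℝ := (2304 * (L : ℝ) ^ 6 * (Fintype.card (Fol L) : ℝ))⁻¹ with hμ
  have hμ0 : 0 < μ := (folMu_pos_le (L := L)).1
  set N : ℝ := (Fintype.card (Fol L) : ℝ) with hN
  have hN3 : (3 : ℝ) ≤ N := by
    have h := nine_le_finrank_gnoFol (L := L)
    rw [finrank_gnoFol_real] at h
    linarith
  have hN1 : 1 ≤ 2 * (3 * N) := by linarith
  have hcentral : ∀ (x : Site 3 L) (k : SU2), k * (fun _ : Site 3 L => (1 : SU2)) x = (fun _ : Site 3 L => (1 : SU2)) x * k := fun x k => by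
    simp
  have h1ne : ((1 : ℝ) : ℍ) ≠ 0 := by exact_mod_cast one_ne_zero
  -- (A) base coercivity of the apex family, and its transport to `ζ` and to `gnoRot u ζ`
  have hbase : ∀ y : GnoFol L, μ * ‖y‖ ^ 2 ≤ ⟪A0 (gnoBase p'.1 p'.2) y, y⟫_ℝ := gnoFolHessian_coercive_base h1ne ε hε.1 hε.2 p'.1 p'.2 hA0ray
  have hζ : ∀ y : GnoFol L, μ / 2 * ‖y‖ ^ 2 ≤ ⟪A0 ζ y, y⟫_ℝ := fun y => by
    have h := gnoFolHessian_coercive_near z₀ (fun _ => (1 : SU2)) h1ne ε hA0amb hbase ζ y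
    have hsmall : 44712000 * (L : ℝ) ^ 4 * ‖ζ - gnoBase p'.1 p'.2‖ ≤ μ / 2 := by
      refine hflat.trans ?_
      rw [div_le_div_iff₀ (by positivity) (by norm_num)]
      nlinarith
    nlinarith [sq_nonneg ‖y‖]
  have hη : ∀ y : GnoFol L, μ / 2 * ‖y‖ ^ 2 ≤ ⟪A0 (gnoRot u ζ) y, y⟫_ℝ := gnoFolHessian_apex_coercive_rot z₀ hcentral ε hA0yy hu hζ
  -- (B) the angle step at `η = gnoRot u ζ`: `|log det A_t η − log det A₀ η| ≤ 1`
  have hA0ambθ : ∀ η (y : GnoFol L), ⟪A0 η y, y⟫_ℝ = iteratedFDeriv ℝ 2 (gnoDeficit z₀ (fun _ => 1) (angUnit 0) ε) η (fun _ => gnoFolEmb y) := fun η y => by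
    rw [angUnit_zero]; exact hA0amb η y
  have hsin0 : 0 ≤ Real.sin 0 := by rw [Real.sin_zero]
  have hnearθ : (122689728 * |θt - 0| + 44712000 * ‖gnoRot u ζ - gnoRot u ζ‖) * (L : ℝ) ^ 4 ≤ (μ / 2) / 2 := by
    rw [sub_zero, sub_self, norm_zero, mul_zero, add_zero]
    refine hwinθ.trans ?_
    rw [div_div, div_le_div_iff₀ (by positivity) (by norm_num)]
    nlinarith
  have hlogθ := abs_log_det_gnoFolHessian_sub_le_joint z₀ (fun _ => (1 : SU2)) hθt hsin0 ε hAts hA0s hAtamb hA0ambθ (by positivity : 0 < μ / 2) hη hnearθ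
  rw [sub_zero, sub_self, norm_zero, mul_zero, add_zero] at hlogθ
  have hB : |Real.log (LinearMap.det (At (gnoRot u ζ))) - Real.log (LinearMap.det (A0 (gnoRot u ζ)))| ≤ 1 := by
    refine hlogθ.trans ?_
    rw [div_le_one (by positivity)]
    calc 2 * (3 * N) * (122689728 * |θt| * (L : ℝ) ^ 4) ≤ 2 * (3 * N) * (μ / (4 * (3 * N))) := by gcongr
      _ = μ / 2 := by field_simp; ring
  -- (C) the exact apex symmetry and the translation step at the apex
  have hC : LinearMap.det (A0 (gnoRot u ζ)) = LinearMap.det (A0 ζ) := det_gnoFolHessian_apex_rot z₀ hcentral ε hA0s hA0yy hu ζ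
  have hnearT : 44712000 * (L : ℝ) ^ 4 * ‖ζ - gnoBase p'.1 p'.2‖ ≤ μ / 2 := by
    refine hflat.trans ?_
    rw [div_le_div_iff₀ (by positivity) (by norm_num)]
    nlinarith
  have hlogT := abs_log_det_gnoFolHessian_sub_le z₀ (fun _ => (1 : SU2)) h1ne ε hA0s hA0amb hμ0 hbase hnearT
  have hD : |Real.log (LinearMap.det (A0 ζ)) - Real.log (LinearMap.det (A0 (gnoBase p'.1 p'.2)))| ≤ 1 := by
    refine hlogT.trans ?_
    rw [div_le_one hμ0]
    calc 2 * (3 * N) * (44712000 * (L : ℝ) ^ 4 * ‖ζ - gnoBase p'.1 p'.2‖) ≤ 2 * (3 * N) * (μ / (2 * (3 * N))) := by gcongr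
      _ = μ := by field_simp
  -- assemble
  rw [hC] at hB
  calc |Real.log (LinearMap.det (At (gnoRot u ζ))) - Real.log (LinearMap.det (A0 (gnoBase p'.1 p'.2)))|
      = |(Real.log (LinearMap.det (At (gnoRot u ζ))) - Real.log (LinearMap.det (A0 ζ))) +
          (Real.log (LinearMap.det (A0 ζ)) - Real.log (LinearMap.det (A0 (gnoBase p'.1 p'.2))))| := by ring_nf
    _ ≤ |Real.log (LinearMap.det (At (gnoRot u ζ))) - Real.log (LinearMap.det (A0 ζ))| +
          |Real.log (LinearMap.det (A0 ζ)) - Real.log (LinearMap.det (A0 (gnoBase p'.1 p'.2)))| := abs_add_le _ _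
    _ ≤ 1 + 1 := add_le_add hB hD
    _ = 2 := by norm_num

/-- ★★ **APEX BASE POINT AGAINST SHELL BASE POINT**: for the apex family `A₀` (ray identity at hub `1`) and any family `A_s` at a hub `angUnit θ_s` (`0 ≤ sin θ_s`) in the
angle window `122689728·|θ_s|·L⁴ ≤ μ_F∕(2·3|Fol L|)`: `|log det A₀(gnoBase p′) − log det A_s(gnoBase p′)| ≤ 1`. [cite: Breitung1994, Lemma 26] -/
theorem abs_log_det_apex_base_le {ε : GnoSign L} (hε : GoodSign ε) {θs : ℝ} (hθs : 0 ≤ Real.sin θs)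
    {A0 : GnoCoord L → GnoFol L →ₗ[ℝ] GnoFol L} (hA0s : ∀ η, (A0 η).IsSymmetric)
    (hA0amb : ∀ η (y : GnoFol L), ⟪A0 η y, y⟫_ℝ = iteratedFDeriv ℝ 2 (gnoDeficit z₀ (fun _ => 1) ((1 : ℝ) : ℍ) ε) η (fun _ => gnoFolEmb y))
    {As : GnoCoord L → GnoFol L →ₗ[ℝ] GnoFol L} (hAss : ∀ η, (As η).IsSymmetric)
    (hAsray : ∀ η (y : GnoFol L), ⟪As η y, y⟫_ℝ = iteratedDeriv 2 (fun s : ℝ => gnoDeficit (fun _ => false) (fun _ => 1) (angUnit θs) ε (η + s • gnoFolEmb y)) 0)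
    (hAsamb : ∀ η (y : GnoFol L), ⟪As η y, y⟫_ℝ = iteratedFDeriv ℝ 2 (gnoDeficit z₀ (fun _ => 1) (angUnit θs) ε) η (fun _ => gnoFolEmb y))
    (hwinθ : 122689728 * |θs| * (L : ℝ) ^ 4 ≤ (2304 * (L : ℝ) ^ 6 * (Fintype.card (Fol L) : ℝ))⁻¹ / (2 * (3 * (Fintype.card (Fol L) : ℝ))))
    (p' : ℝ × ℝ) :
    |Real.log (LinearMap.det (A0 (gnoBase p'.1 p'.2))) - Real.log (LinearMap.det (As (gnoBase p'.1 p'.2)))| ≤ 1 := by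
  have hL : (0 : ℝ) < (L : ℝ) := Nat.cast_pos.2 (Nat.pos_of_ne_zero (NeZero.ne L))
  set μ : ℝ := (2304 * (L : ℝ) ^ 6 * (Fintype.card (Fol L) : ℝ))⁻¹ with hμ
  have hμ0 : 0 < μ := (folMu_pos_le (L := L)).1
  set N : ℝ := (Fintype.card (Fol L) : ℝ) with hN
  have hN3 : (3 : ℝ) ≤ N := by
    have h := nine_le_finrank_gnoFol (L := L)
    rw [finrank_gnoFol_real] at h
    linarith
  have hN1 : 1 ≤ 2 * (3 * N) := by linarith
  have hbase : ∀ y : GnoFol L, μ * ‖y‖ ^ 2 ≤ ⟪As (gnoBase p'.1 p'.2) y, y⟫_ℝ := gnoFolHessian_coercive_base (angUnit_ne_zero θs) ε hε.1 hε.2 p'.1 p'.2 hAsray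
  have hA0ambθ : ∀ η (y : GnoFol L), ⟪A0 η y, y⟫_ℝ = iteratedFDeriv ℝ 2 (gnoDeficit z₀ (fun _ => 1) (angUnit 0) ε) η (fun _ => gnoFolEmb y) := fun η y => by
    rw [angUnit_zero]; exact hA0amb η y
  have hsin0 : 0 ≤ Real.sin 0 := by rw [Real.sin_zero]
  have hnear : (122689728 * |0 - θs| + 44712000 * ‖(gnoBase p'.1 p'.2 : GnoCoord L) - gnoBase p'.1 p'.2‖) * (L : ℝ) ^ 4 ≤ μ / 2 := by
    rw [zero_sub, abs_neg, sub_self, norm_zero, mul_zero, add_zero]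
    refine hwinθ.trans ?_
    rw [div_le_div_iff₀ (by positivity) (by norm_num)]
    nlinarith
  have hlog := abs_log_det_gnoFolHessian_sub_le_joint z₀ (fun _ => (1 : SU2)) hsin0 hθs ε hA0s hAss hA0ambθ hAsamb hμ0 hbase hnear
  rw [zero_sub, abs_neg, sub_self, norm_zero, mul_zero, add_zero] at hlog
  refine hlog.trans ?_
  rw [div_le_one hμ0]
  calc 2 * (3 * N) * (122689728 * |θs| * (L : ℝ) ^ 4) ≤ 2 * (3 * N) * (μ / (2 * (3 * N))) := by gcongr
    _ = μ := by field_simp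

end Summit.QuantumFields.YangMills.Theorems.SwapVirialDeficit.SectorLaplace

end
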